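import Literature.NumberTheory.Automorphic.AutomorphicLFunctionsProofs
import Literature.NumberTheory.Automorphic.AutomorphicSpectrumProofs
import Literature.NumberTheory.Automorphic.HilbertRepSchur
import Literature.NumberTheory.Automorphic.SatakeParameterUnitBound
import Literature.NumberTheory.Automorphic.UnramifiedHeckeScalarsFlathProofs
import Literature.NumberTheory.Automorphic.GodementJacquetPartialL
import Literature.NumberTheory.Automorphic.GodementJacquetPartialLProofs
import Literature.NumberTheory.Automorphic.AutomorphicTwist
import Literature.NumberTheory.GaloisRepresentations.HeckeCharacterDictionary
import Literature.NumberTheory.LFunctions.DedekindZetaThetaProofs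
import Literature.NumberTheory.LFunctions.DedekindZetaNonvanishing
import HarnessLib

/-!
# Standard L-functions of `GL_1`: cuspidal automorphic representations of `GL_1(𝔸_K)` are
Hecke characters, and lang.S21 for `n = 1` is Tate's theorem

Topic `NumberTheory/Automorphic`; companion to `AutomorphicLFunctions` (the named fact
`Literature.NumberTheory.Automorphic.partialStandardL_hasMeromorphicContinuation`, statement **lang.S21**, partial
L-functions) and its proof files `AutomorphicLFunctionsProofs`, `GodementJacquetPartialL`,
`GodementJacquetPartialLProofs`, `GodementJacquetContinuation`.

The named fact says: for every cuspidal automorphic representation `Π` of `GL_n(𝔸_K)`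
(`CuspidalAutomorphicRepGL n K μ`: a topologically irreducible closed subrepresentation of the
honest `L²_cusp(GL_n(𝔸_K) ⧸ ℝ_{>0} GL_n(K))`), every finite `S ⊇` ramified places and every honest
Satake family `α` of `Π` off `S`, the partial Euler product `L^S(s, Π)` (`partialStandardL`) agrees
on `re s > 1` with a function meromorphic on `ℂ`. Over the tree's honest definitions this is
Godement–Jacquet (1972), Thm. 13.8 (continuation from a half-plane) together with Jacquet–Shalika
(1981), Thm. (5.3) (holomorphy on `re s > 1`); the tree holds the sorry-free assembly from these two
printed inputs (`partialStandardL_hasMeromorphicContinuation_of_halfPlane`), the second being proved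
for `n ≤ 1` (`JacquetShalika1981_differentiableOn_partialStandardL_of_le_one`).

This file **settles the case `n = 1` down to Tate's theorem** and records the frontier for general
`n` with all inputs that are now theorems of the tree inlined.

## `GL_1`: cuspidal automorphic representations are unitary Hecke characters (all proved)

For a topologically irreducible closed subrepresentation `W` of the regular representation `R`
of `GL_1(𝔸_K)` on `L²(GL_1(𝔸_K) ⧸ ℝ_{>0} GL_1(K))` (in particular for `Π.1`, `Π` cuspidal):

* `GLOne.exists_toContRep_apply_eq_smul`: every `R(g)` acts on `W` by a scalar `ω_W(g)`
  (`GLOne.eigenvalue`) — Schur's lemma for the irreducible *unitary* `W` (`HilbertRepSchur`,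
  Deitmar–Echterhoff (2014), Lemma 6.1.7) applied to `R(g)|_W`, which commutes with `W` because
  `GL_1(𝔸_K)` is commutative;
* `ω_W` is a unitary character (`GLOne.norm_eigenvalue`, `eigenvalue_mul`: `R` acts by
  isometries), continuous (`GLOne.continuous_eigenvalue`: `ω_W(g) = ⟪f, R(g) f⟫ / ⟪f, f⟫` and `R`
  is strongly continuous, `isStronglyContinuous_rightRegular_holds`), and trivial on
  `ℝ_{>0} · GL_1(K)` (`GLOne.eigenvalue_eq_one_of_mem_quotientSubgroup`: in a commutative group
  `R(γ) f = f(γ⁻¹ ·) = f` for `γ` in the subgroup divided out,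
  `AdelicGroupData.rightRegular_apply_eq_self_of_mem_quotientSubgroup`);
* `ω_W` is thereby a unitary automorphic character of `GL_1(𝔸_K)` in the sense of
  `AdelicGroupData.AutomorphicCharacter` of `AutomorphicTwist` (`GLOne.automorphicCharacter`,
  **definition**; this connects `GL_1` to the twisting machinery `ClosedSubrep.twist`);
* hence `χ_W(x) = ω_W(scalar x)` is a **Hecke character** of `K` in the sense of
  `Literature.NumberTheory.GaloisRepresentations.HeckeCharacter` (continuous `𝔸_Kˣ →* ℂˣ` trivial on
  `Kˣ`): `GLOne.heckeCharacter`, `CuspidalAutomorphicRepGL.heckeCharacter` (**definitions**), unitary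
  (`isUnitary_heckeCharacter`);
* **honest Satake parameters are values of `χ_W`**: the Hecke element `t_{v,1}` is the scalar
  matrix of the local idele of `ϖ` (`heckeDiagAt_one_one_eq_scalar`), the double-coset operator
  `T_{v,1}` is the single translation `R(t_{v,1})` (`heckeOperatorAt_eq_toContRep_apply`), so
  `HasSatakeParameterAt W Kf v ϖ α` forces `α = {χ_W(ϖ at v)}` at *every* level `Kf`
  (`HasSatakeParameterAt.eq_singleton_heckeCharacter`); an unramified `W` (a `K(𝔫)`-fixed vector,
  `v ∤ 𝔫`) has `χ_W` unramified at `v` (`GLOne.isUnramifiedAt_heckeCharacter`: `K(𝔫)` contains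
  `GL_1(𝒪_v) ↪ GL_1(𝔸_K)`, `isMaximalAt_principalCongruenceLevel`, and
  `scalar (localUnits v u) = GLn.ofLocal (u)`, `scalar_localUnits_eq_ofLocal`), whence the honest
  parameter is the classical `χ_W(ϖ_v)` (`HeckeCharacter.valueAtUniformizer`, independent of the
  uniformizer: `HasSatakeParameterAt.eq_singleton_valueAtUniformizer`,
  `IsSatakeFamilyOf.eq_singleton_valueAtUniformizer`);
* therefore **`L^S(s, Π) = L^S(s, χ_Π) = ∏_{v ∉ S} (1 - χ_Π(ϖ_v) q_v^{-s})⁻¹`** for every honest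
  Satake family of a cuspidal `Π : GL_1` off any `S`
  (`CuspidalAutomorphicRepGL.partialStandardL_eq_tprod_heckeCharacter`; both sides the same `tprod`).

## lang.S21 for `n = 1` from Tate's theorem (proved implications)

* `HeckeCharacter.hasMeromorphicContinuation_tprod_of_tate`: for a unitary Hecke character `χ`
  unramified outside the finite `S`, the meromorphic continuation of `L(s, χ)`
  (`LFunction.HasMeromorphicContinuation (heckeLFunction χ)`) implies that of
  `L^S(s, χ) = ∏_{v ∉ S} (1 - χ(ϖ_v) q_v^{-s})⁻¹` — the finitely many Euler factors at
  `v ∈ S` are entire with isolated zeros (`HeckeCharacter.heckeLFunction_eq_prod_mul_tprod` of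
  `HeckeCharacterDictionary` with `𝔪 = ∏_{v ∈ S} 𝔭_v`, the proved convergence
  `multipliable_heckeLFunction_holds`, and the patching lemma
  `LFunction.hasMeromorphicContinuation_of_eventually_eq`);
* `hasMeromorphicContinuation_partialStandardL_of_tate`,
  `partialStandardL_hasMeromorphicContinuation_one_of_tate`: **the named fact for `n = 1` follows
  from `heckeLFunction_hasMeromorphicContinuation`** (Tate (1950), Thm. 4.4.1; Hecke (1920)) — the
  named fact of `GaloisRepresentations/HeckeCharacter` on which the abelian/Brauer Artin cluster
  (`ArtinLFunctionsBrauer`) also rests; likewise the half-plane form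
  `GodementJacquet1972_meromorphic_partialStandardL` (`…_one_of_tate`) and the sibling fact
  `godementJacquet_hasMeromorphicContinuation` (`…_one_of_tate`) for `n = 1`;
* `hasMeromorphicContinuation_partialStandardL_of_isFiniteOrder`: if `χ_Π` has finite order,
  Hecke's 1917 theorem for ray class L-series (`rayClassLSeries_hasMeromorphicContinuation K`,
  through `HeckeCharacter.hasMeromorphicContinuation_of_isFiniteOrder`) suffices;
* `hasMeromorphicContinuation_partialStandardL_of_isTrivialSubrep_holds`: the trivial `Π` of `GL_1`
  (`L^S = ζ_K^S`) is now **unconditional** (Hecke's theorems `exists_isDedekindZetaContinuation_holds`,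
  `tendsto_sub_one_mul_dedekindZetaCont_holds` are proved in the tree).

## General `n`: the frontier with proved inputs inlined

* `partialStandardL_hasMeromorphicContinuation_of_godementJacquet_of_JS`: the named fact from the
  existence form `godementJacquet` of lang.S21 and Jacquet–Shalika's `multipliable_partialStandardL`
  only (Flath's theorem `Flath1979_heckeOperatorAt_ofLocal_eq_smul_holds` and Hecke's theorems being
  proved); `partialStandardL_hasMeromorphicContinuation_of_GJ_of_JS`: the same from the meromorphic
  form `godementJacquet_hasMeromorphicContinuation`;
* `partialStandardL_hasMeromorphicContinuation_of_GJ_of_le_one`: for `n ≤ 1` the single input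
  `GodementJacquet1972_meromorphic_partialStandardL` suffices.

What remains named (each a theory absent from Mathlib): for `n = 1`, Tate's Thm. 4.4.1
(`heckeLFunction_hasMeromorphicContinuation`; its finite-order case reduces to Hecke 1917); for
`n ≥ 2`, Godement–Jacquet's global theory (`GodementJacquet1972_gjZeta_meromorphic`,
`GodementJacquet1972_gjZeta_eulerFactorisation` of `GodementJacquetZetaIntegrals`) and
Jacquet–Shalika's Lemma (5.2) (Rankin–Selberg, behind `summable_normSq_trace_satakePow`).

## References

* J. Tate, *Fourier analysis in number fields and Hecke's zeta-functions* (1950), in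
  Cassels–Fröhlich, *Algebraic Number Theory* (1967), Ch. XV: §4.3–4.4, Thm. 4.4.1 [TateThesis1967].
* R. Godement, H. Jacquet, *Zeta functions of simple algebras*, LNM 260 (1972), Thm. 13.8
  [GodementJacquet1972].
* H. Jacquet, R. P. Langlands, *Automorphic Forms on GL(2)*, LNM 114 (1970), §9, §12 (automorphic
  forms on `GL(1)` = idele class characters).
* H. Jacquet, J. A. Shalika, Amer. J. Math. 103 (1981), Thm. (5.3) [JacquetShalikaAJM1981].
* A. Deitmar, S. Echterhoff, *Principles of Harmonic Analysis*, 2nd ed. (2014), Lemma 6.1.7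
  [DeitmarEchterhoff2014].
* J. Neukirch, *Algebraic Number Theory* (1999), Ch. VII §8, remark before Thm. (8.5)
  [NeukirchANT1999].
-/

noncomputable section

open scoped MatrixGroups InnerProductSpace
open NumberField IsDedekindDomain MeasureTheory Complex Filter Topology Polynomial

/-! ### Two general lemmas -/

/-- A homomorphism `φ : G →* Mˣ` on a topological group is continuous as soon as
`g ↦ (φ g : M)` is: the second coordinate of the units embedding is `g ↦ φ(g⁻¹)`. [folklore] -/
theorem MonoidHom.continuous_of_continuous_val {G M : Type*} [Group G] [TopologicalSpace G]
    [ContinuousInv G] [Monoid M] [TopologicalSpace M] (φ : G →* Mˣ)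
    (h : Continuous fun g => (φ g : M)) : Continuous φ := by
  refine Units.continuous_iff.mpr ⟨h, (h.comp continuous_inv).congr fun g => ?_⟩
  simp only [Function.comp_apply, map_inv]

namespace Literature.NumberTheory.Automorphic

/-- `∏_{a ∈ {b}} (1 - a x) = 1 - b x`. [folklore] -/
theorem eval_eulerPolynomial_singleton (b x : ℂ) : (eulerPolynomial {b}).eval x = 1 - b * x := by
  rw [eval_eulerPolynomial, Multiset.map_singleton, Multiset.prod_singleton]

/-! ### The regular representation of a commutative group is trivial on `A_G · G(K)` -/

section Commutative

variable {K : Type} [Field K] [NumberField K] (𝒢 : AdelicGroupData K)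
  (μ : Measure 𝒢.automorphicQuotient)
  [SMulInvariantMeasure 𝒢.Adelic 𝒢.automorphicQuotient μ]

/-- If `G(𝔸_K)` is commutative, every `γ ∈ A_G · G(K)` acts trivially on the automorphic
quotient `G(𝔸_K) ⧸ A_G G(K)`: `γ • [y] = [γ y] = [y γ] = [y]`. [folklore] -/
theorem AdelicGroupData.smul_eq_self_of_mem_quotientSubgroup
    (hcomm : ∀ a b : 𝒢.Adelic, a * b = b * a) {γ : 𝒢.Adelic} (hγ : γ ∈ 𝒢.quotientSubgroup)
    (x : 𝒢.automorphicQuotient) : γ • x = x := by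
  have hsurj : Function.Surjective 𝒢.toAutomorphicQuotient := QuotientGroup.mk_surjective
  obtain ⟨y, rfl⟩ := hsurj x
  rw [𝒢.smul_toAutomorphicQuotient]
  change (QuotientGroup.mk (γ * y) : 𝒢.Adelic ⧸ 𝒢.quotientSubgroup) = QuotientGroup.mk y
  refine QuotientGroup.eq.mpr ?_
  rw [hcomm γ y, mul_inv_rev, mul_assoc, inv_mul_cancel, mul_one]
  exact inv_mem hγ

/-- If `G(𝔸_K)` is commutative, the regular representation `R` on `L²(G(𝔸_K) ⧸ A_G G(K))` is
trivial on `A_G · G(K)`: `R(γ) f = f (γ⁻¹ • ·) = f`. [folklore] -/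
theorem AdelicGroupData.rightRegular_apply_eq_self_of_mem_quotientSubgroup
    (hcomm : ∀ a b : 𝒢.Adelic, a * b = b * a) {γ : 𝒢.Adelic} (hγ : γ ∈ 𝒢.quotientSubgroup)
    (f : 𝒢.L2 μ) : 𝒢.rightRegular μ γ f = f := by
  refine Lp.ext ?_
  filter_upwards [𝒢.rightRegular_apply_coeFn μ γ f] with x hx
  rw [hx, 𝒢.smul_eq_self_of_mem_quotientSubgroup hcomm (inv_mem hγ) x]

end Commutative

/-! ### The eigencharacter of an irreducible closed subrepresentation of `L²(GL_1)` -/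

section EigenCharacter

variable {K : Type} [Field K] [NumberField K]
  {μ : Measure (AdelicGroupData.gl 1 K).automorphicQuotient}
  [(AdelicGroupData.gl 1 K).IsAutomorphicMeasure μ]
  {W : ContRepresentation.ClosedSubrep ((AdelicGroupData.gl 1 K).rightRegular μ)}

namespace GLOne

/-- `GL_1(𝔸_K)` is commutative. [folklore] -/
theorem mul_comm (a b : (AdelicGroupData.gl 1 K).Adelic) : a * b = b * a :=
  gl_mul_comm_of_subsingleton a b

/-- **Schur for `GL_1`.** On a topologically irreducible closed subrepresentation `W` of
`L²(GL_1(𝔸_K) ⧸ ℝ_{>0} GL_1(K))` every `R(g)`, `g ∈ GL_1(𝔸_K)`, acts by a scalar: `GL_1(𝔸_K)` is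
commutative, so `R(g)|_W` commutes with the irreducible unitary representation `W`
(`ContRepresentation.IsTopIrreducible.exists_apply_eq_smul_of_commute`, Deitmar–Echterhoff (2014),
Lemma 6.1.7). [cite: DeitmarEchterhoff2014, Lemma 6.1.7] -/
theorem exists_toContRep_apply_eq_smul (hW : W.toContRep.IsTopIrreducible)
    (g : (AdelicGroupData.gl 1 K).Adelic) :
    ∃ c : ℂ, ∀ f : W.toSubmodule, W.toContRep g f = c • f := by
  haveI : CompleteSpace W.toSubmodule := W.isClosed.completeSpace_coe
  have hU : W.toContRep.IsUnitary :=
    ClosedSubrep.isUnitary_toContRep ((AdelicGroupData.gl 1 K).isUnitary_rightRegular μ) W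
  exact hW.exists_apply_eq_smul_of_commute hU fun h =>
    (show Commute h g from mul_comm h g).map W.toContRep

/-- The **eigenvalue** `ω_W(g)` by which `R(g)` acts on the irreducible `W ≤ L²(GL_1)`
(`exists_toContRep_apply_eq_smul`). [folklore] -/
def eigenvalue (hW : W.toContRep.IsTopIrreducible) (g : (AdelicGroupData.gl 1 K).Adelic) : ℂ :=
  (exists_toContRep_apply_eq_smul hW g).choose

/-- `R(g) f = ω_W(g) f` for `f ∈ W`. [folklore] -/
theorem toContRep_apply_eq_eigenvalue_smul (hW : W.toContRep.IsTopIrreducible)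
    (g : (AdelicGroupData.gl 1 K).Adelic) (f : W.toSubmodule) :
    W.toContRep g f = eigenvalue hW g • f :=
  (exists_toContRep_apply_eq_smul hW g).choose_spec f

/-- `W ≠ 0` (irreducible representations are non-zero). [folklore] -/
theorem exists_ne_zero (hW : W.toContRep.IsTopIrreducible) : ∃ f : W.toSubmodule, f ≠ 0 := by
  haveI := ((ContRepresentation.isTopIrreducible_iff _).mp hW).1
  exact exists_ne (0 : W.toSubmodule)

/-- `|ω_W(g)| = 1`: `R(g)` is an isometry of `L²`. [folklore] -/
theorem norm_eigenvalue (hW : W.toContRep.IsTopIrreducible) (g : (AdelicGroupData.gl 1 K).Adelic) :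
    ‖eigenvalue hW g‖ = 1 := by
  obtain ⟨f, hf⟩ := exists_ne_zero hW
  have h := norm_toContRep_apply W g f
  rw [toContRep_apply_eq_eigenvalue_smul hW g f, norm_smul] at h
  exact (mul_eq_right₀ (norm_ne_zero_iff.mpr hf)).mp h

/-- `ω_W(g) ≠ 0`. [folklore] -/
theorem eigenvalue_ne_zero (hW : W.toContRep.IsTopIrreducible)
    (g : (AdelicGroupData.gl 1 K).Adelic) : eigenvalue hW g ≠ 0 := by
  rw [← norm_ne_zero_iff, norm_eigenvalue hW g]
  exact one_ne_zero

/-- The eigencharacter is `1` on every element fixing a non-zero vector of `W`. [folklore] -/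
theorem eigenvalue_eq_one_of_apply_eq (hW : W.toContRep.IsTopIrreducible)
    {x : (AdelicGroupData.gl 1 K).Adelic} {f : W.toSubmodule} (hf : f ≠ 0)
    (hx : W.toContRep x f = f) : eigenvalue hW x = 1 := by
  have h := toContRep_apply_eq_eigenvalue_smul hW x f
  rw [hx] at h
  have h' : eigenvalue hW x • f = (1 : ℂ) • f := by rw [one_smul]; exact h.symm
  exact smul_left_injective ℂ hf h'

/-- `ω_W(1) = 1`. [folklore] -/
theorem eigenvalue_one (hW : W.toContRep.IsTopIrreducible) : eigenvalue hW 1 = 1 := by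
  obtain ⟨f, hf⟩ := exists_ne_zero hW
  refine eigenvalue_eq_one_of_apply_eq hW hf ?_
  rw [map_one]
  rfl

/-- `ω_W(g h) = ω_W(g) ω_W(h)`. [folklore] -/
theorem eigenvalue_mul (hW : W.toContRep.IsTopIrreducible)
    (g h : (AdelicGroupData.gl 1 K).Adelic) :
    eigenvalue hW (g * h) = eigenvalue hW g * eigenvalue hW h := by
  obtain ⟨f, hf⟩ := exists_ne_zero hW
  have h1 : eigenvalue hW (g * h) • f = (eigenvalue hW g * eigenvalue hW h) • f :=
    calc eigenvalue hW (g * h) • f = W.toContRep (g * h) f :=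
          (toContRep_apply_eq_eigenvalue_smul hW _ f).symm
      _ = W.toContRep g (W.toContRep h f) := by rw [map_mul]; rfl
      _ = W.toContRep g (eigenvalue hW h • f) := by rw [toContRep_apply_eq_eigenvalue_smul hW h f]
      _ = eigenvalue hW h • W.toContRep g f := map_smul _ _ _
      _ = eigenvalue hW h • (eigenvalue hW g • f) := by
          rw [toContRep_apply_eq_eigenvalue_smul hW g f]
      _ = (eigenvalue hW h * eigenvalue hW g) • f := smul_smul _ _ _
      _ = (eigenvalue hW g * eigenvalue hW h) • f := by rw [_root_.mul_comm (eigenvalue hW h)]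
  exact smul_left_injective ℂ hf h1

/-- The eigencharacter `ω_W : GL_1(𝔸_K) →* ℂ` as a monoid homomorphism. [folklore] -/
def eigenvalueHom (hW : W.toContRep.IsTopIrreducible) : (AdelicGroupData.gl 1 K).Adelic →* ℂ where
  toFun := eigenvalue hW
  map_one' := eigenvalue_one hW
  map_mul' := eigenvalue_mul hW

/-- Unfolding `eigenvalueHom`. [folklore] -/
@[simp]
theorem eigenvalueHom_apply (hW : W.toContRep.IsTopIrreducible)
    (g : (AdelicGroupData.gl 1 K).Adelic) : eigenvalueHom hW g = eigenvalue hW g := rfl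

/-- **Continuity of the eigencharacter**, from the strong continuity of the regular
representation (`isStronglyContinuous_rightRegular_holds`): for `0 ≠ f ∈ W`,
`ω_W(g) = ⟪f, R(g) f⟫ / ⟪f, f⟫`. [folklore] -/
theorem continuous_eigenvalue (hW : W.toContRep.IsTopIrreducible) : Continuous (eigenvalue hW) := by
  obtain ⟨f, hf⟩ := exists_ne_zero hW
  have hsc := (AdelicGroupData.gl 1 K).isStronglyContinuous_rightRegular_holds μ
    (f : (AdelicGroupData.gl 1 K).L2 μ)
  have hcont : Continuous fun g : (AdelicGroupData.gl 1 K).Adelic => W.toContRep g f := by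
    refine continuous_induced_rng.2 ?_
    simp only [Function.comp_def, ContRepresentation.ClosedSubrep.coe_toContRep_apply]
    exact hsc
  have hff : (⟪f, f⟫_ℂ : ℂ) ≠ 0 := inner_self_ne_zero.mpr hf
  have heq : eigenvalue hW = fun g => ⟪f, W.toContRep g f⟫_ℂ / ⟪f, f⟫_ℂ := by
    funext g
    have h1 : ⟪f, W.toContRep g f⟫_ℂ = eigenvalue hW g * ⟪f, f⟫_ℂ := by
      rw [toContRep_apply_eq_eigenvalue_smul hW g f]
      exact inner_smul_right f f (eigenvalue hW g)
    rw [h1, mul_div_assoc, div_self hff, mul_one]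
  rw [heq]
  exact (continuous_const.inner hcont).div_const _

/-- **The eigencharacter is trivial on `ℝ_{>0} · GL_1(K)`**: `GL_1(𝔸_K)` is commutative, so
`R(γ) = 1` on `L²(GL_1(𝔸_K) ⧸ ℝ_{>0} GL_1(K))` for `γ ∈ ℝ_{>0} · GL_1(K)`
(`AdelicGroupData.rightRegular_apply_eq_self_of_mem_quotientSubgroup`). [folklore] -/
theorem eigenvalue_eq_one_of_mem_quotientSubgroup (hW : W.toContRep.IsTopIrreducible)
    {γ : (AdelicGroupData.gl 1 K).Adelic} (hγ : γ ∈ (AdelicGroupData.gl 1 K).quotientSubgroup) :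
    eigenvalue hW γ = 1 := by
  obtain ⟨f, hf⟩ := exists_ne_zero hW
  exact eigenvalue_eq_one_of_apply_eq hW hf (Subtype.ext
    ((AdelicGroupData.gl 1 K).rightRegular_apply_eq_self_of_mem_quotientSubgroup μ mul_comm hγ f))

/-! ### The Hecke character of an irreducible `W ≤ L²(GL_1)` -/

/-- The scalar embedding `𝔸_Kˣ →* GL_1(𝔸_K)` is continuous (`Units.map` of the continuous ring
homomorphism `Matrix.scalar`). [folklore] -/
theorem continuous_scalar_adele :
    Continuous (Matrix.GeneralLinearGroup.scalar (Fin 1) :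
      (AdeleRing (𝓞 K) K)ˣ → GL (Fin 1) (AdeleRing (𝓞 K) K)) := by
  refine Units.continuous_map ?_
  change Continuous fun a : AdeleRing (𝓞 K) K => Matrix.scalar (Fin 1) a
  simp only [Matrix.scalar_apply]
  exact (continuous_pi fun _ => continuous_id).matrix_diagonal

/-- **The Hecke character of an irreducible closed subrepresentation `W` of `L²(GL_1)`**:
`χ_W(x) = ω_W(scalar x)`, the eigenvalue of `R(x)` on `W ≤ L²(GL_1(𝔸_K) ⧸ ℝ_{>0} GL_1(K))`
(Schur), a continuous homomorphism `𝔸_Kˣ → ℂˣ` (strong continuity of `R`) trivial on `Kˣ`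
(indeed on `ℝ_{>0} · Kˣ`). Classically: the irreducible constituents of `L²` of the compact abelian
group `𝔸_Kˣ ⧸ ℝ_{>0} Kˣ` are the lines spanned by its unitary characters, and `W = ℂ · χ_W⁻¹` (as
a function; `R(g) φ = φ(g⁻¹ ·)`). This is the case `n = 1` of the cuspidal automorphic
representations of `GL_n` (Jacquet–Langlands (1970), §9, §12; Gelbart, *Automorphic forms on
adele groups* (1975), §2; Tate (1950), §4). [folklore] -/
def heckeCharacter (hW : W.toContRep.IsTopIrreducible) : GaloisRepresentations.HeckeCharacter K where
  toContinuousMonoidHom :=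
    { toMonoidHom := (eigenvalueHom hW).toHomUnits.comp (Matrix.GeneralLinearGroup.scalar (Fin 1))
      continuous_toFun := MonoidHom.continuous_of_continuous_val _
        ((continuous_eigenvalue hW).comp continuous_scalar_adele) }
  map_principal' x hx := by
    obtain ⟨q, rfl⟩ := hx
    refine Units.ext ?_
    change eigenvalue hW (Matrix.GeneralLinearGroup.scalar (Fin 1)
      (Units.map (algebraMap K (AdeleRing (𝓞 K) K) : K →* AdeleRing (𝓞 K) K) q)) = 1
    rw [← Matrix.GeneralLinearGroup.map_scalar]
    exact eigenvalue_eq_one_of_mem_quotientSubgroup hW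
      ((AdelicGroupData.gl 1 K).arithmeticSubgroup_le_quotientSubgroup ⟨_, rfl⟩)

/-- Unfolding the Hecke character of `W`: `χ_W(x) = ω_W(scalar x)`. [folklore] -/
@[simp]
theorem coe_heckeCharacter_apply (hW : W.toContRep.IsTopIrreducible) (x : (AdeleRing (𝓞 K) K)ˣ) :
    ((heckeCharacter hW x : ℂˣ) : ℂ) =
      eigenvalue hW (Matrix.GeneralLinearGroup.scalar (Fin 1) x) :=
  rfl

/-- **`χ_W` is unitary**: `|χ_W(x)| = |ω_W(scalar x)| = 1` (`R` acts by isometries). [folklore] -/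
theorem isUnitary_heckeCharacter (hW : W.toContRep.IsTopIrreducible) :
    (heckeCharacter hW).IsUnitary :=
  fun x => by rw [coe_heckeCharacter_apply, norm_eigenvalue]

/-! ### Honest Satake parameters of `W` are values of `χ_W` -/

/-- The Hecke element `t_{v,1} = (ϖ at v, 1 elsewhere) ∈ GL_1(𝔸_K)` is the scalar matrix of the
local idele `localUnits v ϖ ∈ 𝔸_Kˣ` (both are Mathlib's `RestrictedProduct.mulSingle`). [folklore] -/
theorem heckeDiagAt_one_one_eq_scalar (v : HeightOneSpectrum (𝓞 K)) (ϖ : (v.adicCompletion K)ˣ) :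
    heckeDiagAt 1 K v ϖ 1 =
      Matrix.GeneralLinearGroup.scalar (Fin 1) (GaloisRepresentations.localUnits v ϖ) := by
  refine Matrix.GeneralLinearGroup.ext fun i j => ?_
  obtain rfl : i = 0 := Subsingleton.elim _ _
  obtain rfl : j = 0 := Subsingleton.elim _ _
  simp only [heckeDiagAt, coe_glDiagonal, Matrix.diagonal_apply_eq,
    Matrix.GeneralLinearGroup.coe_scalar, Matrix.scalar_apply]
  rw [if_pos (show ((0 : Fin 1) : ℕ) < 1 by decide)]
  rfl

/-- In rank `1` the Hecke operator `[Kf g Kf]` on a `Kf`-fixed vector is the single translation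
`R(g)` (`GL_1(𝔸_K)` is commutative: `Kf g Kf = g Kf`). [folklore] -/
theorem heckeOperatorAt_eq_toContRep_apply
    (W : ContRepresentation.ClosedSubrep ((AdelicGroupData.gl 1 K).rightRegular μ))
    (Kf : Subgroup (GL (Fin 1) (AdeleRing (𝓞 K) K))) (g : GL (Fin 1) (AdeleRing (𝓞 K) K))
    {f : W.toSubmodule} (hfK : f ∈ W.fixedVectors Kf) :
    heckeOperatorAt W Kf g f = W.toContRep g f := by
  have hbij : Set.BijOn (fun x : GL (Fin 1) (AdeleRing (𝓞 K) K) => (x : _ ⧸ Kf))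
      ({g} : Finset (GL (Fin 1) (AdeleRing (𝓞 K) K))) (MulAction.orbit Kf (g : _ ⧸ Kf)) := by
    rw [Finset.coe_singleton, orbit_mk_eq_singleton_of_subsingleton]
    exact Set.bijOn_singleton.mpr rfl
  have := heckeOperator_apply_eq_sum W.toContRep.toRepresentation Kf g {g} hbij hfK
  erw [Finset.sum_singleton] at this
  exact this

/-- **The honest Satake parameter of `W` at `v` is `{χ_W(ϖ at v)}`** — at *any* level `Kf` and
for the uniformizer `ϖ` used to define `T_{v,1}`: `HasSatakeParameterAt` records
`T_{v,1} f = q_v^0 e_1(α) f` on a non-zero `Kf`-fixed `f ∈ W`, `T_{v,1} = R(t_{v,1})` in rank `1`,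
and `R(t_{v,1})` acts on `W` by `ω_W(t_{v,1}) = χ_W(localUnits v ϖ)`. [folklore] -/
theorem _root_.Literature.NumberTheory.Automorphic.HasSatakeParameterAt.eq_singleton_heckeCharacter
    (hW : W.toContRep.IsTopIrreducible) {Kf : Subgroup (GL (Fin 1) (AdeleRing (𝓞 K) K))}
    {v : HeightOneSpectrum (𝓞 K)} {ϖ : (v.adicCompletion K)ˣ} {α : Multiset ℂ}
    (h : HasSatakeParameterAt W Kf v ϖ α) :
    α = {((heckeCharacter hW (GaloisRepresentations.localUnits v ϖ) : ℂˣ) : ℂ)} := by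
  obtain ⟨-, hcard, f, hfK, hf0, heig⟩ := h
  obtain ⟨b, rfl⟩ := Multiset.card_eq_one.mp hcard
  have h1 := heig 1 le_rfl
  have he : ({b} : Multiset ℂ).esymm 1 = b := by
    simp [Multiset.esymm, Multiset.powersetCard_one]
  rw [he] at h1
  simp only [Nat.sub_self, mul_zero, pow_zero, one_mul] at h1
  rw [heckeOperatorAt_eq_toContRep_apply W Kf _ hfK, heckeDiagAt_one_one_eq_scalar,
    toContRep_apply_eq_eigenvalue_smul hW] at h1
  rw [Multiset.singleton_inj, coe_heckeCharacter_apply]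
  exact (smul_left_injective ℂ hf0 h1).symm

/-- The local scalar `scalar (localUnits v u) ∈ GL_1(𝔸_K)` is the local embedding
`GLn.ofLocal` of the `1 × 1` matrix `(u) ∈ GL_1(K_v)` (componentwise check: `u` at `v`, `1` at
`w ≠ v` and at infinity). [folklore] -/
theorem scalar_localUnits_eq_ofLocal (v : HeightOneSpectrum (𝓞 K)) (u : (v.adicCompletion K)ˣ) :
    Matrix.GeneralLinearGroup.scalar (Fin 1) (GaloisRepresentations.localUnits v u) =
      GLn.ofLocal 1 K v (Matrix.GeneralLinearGroup.scalar (Fin 1) u) := by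
  refine Matrix.GeneralLinearGroup.ext fun i j => ?_
  obtain rfl : i = 0 := Subsingleton.elim _ _
  obtain rfl : j = 0 := Subsingleton.elim _ _
  rw [GLn.coe_ofLocal_apply]
  simp only [Matrix.GeneralLinearGroup.coe_scalar, Matrix.scalar_apply, Matrix.diagonal_apply_eq,
    Matrix.one_apply_eq]
  refine Prod.ext ?_ ?_
  · change (1 : InfiniteAdeleRing K) = (1 : InfiniteAdeleRing K) + (adeleSingleHom K v (↑u - 1)).1
    rw [adeleSingleHom_apply_fst, add_zero]
  · change GaloisRepresentations.finiteAdeleSingle v (u : v.adicCompletion K) =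
      (1 : FiniteAdeleRing (𝓞 K) K) + (adeleSingleHom K v (↑u - 1)).2
    rw [adeleSingleHom_apply_snd]
    refine FiniteAdeleRing.ext K fun w => ?_
    change GaloisRepresentations.finiteAdeleSingle v (u : v.adicCompletion K) w =
      (1 : FiniteAdeleRing (𝓞 K) K) w + finiteAdeleSingleHom K v (↑u - 1) w
    by_cases hw : w = v
    · rw [hw, GaloisRepresentations.finiteAdeleSingle_apply_self, finiteAdeleSingleHom_apply_self]
      change (u : v.adicCompletion K) = 1 + (↑u - 1)
      exact (add_sub_cancel 1 (u : v.adicCompletion K)).symm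
    · rw [GaloisRepresentations.finiteAdeleSingle_apply_of_ne _ hw,
        finiteAdeleSingleHom_apply_of_ne K v _ hw, add_zero]
      rfl

/-- The `1 × 1` matrix of an integral unit `U ∈ 𝒪_vˣ ⊆ K_vˣ` lies in `GL_1(𝒪_v)` (the valued
congruence subgroup of radius `1`). [folklore] -/
theorem scalar_mem_valuedCongruenceSubgroup_one (v : HeightOneSpectrum (𝓞 K))
    {U : (v.adicCompletion K)ˣ} (hU : Valued.v (U : v.adicCompletion K) ≤ 1)
    (hU' : Valued.v ((U⁻¹ : (v.adicCompletion K)ˣ) : v.adicCompletion K) ≤ 1) :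
    Matrix.GeneralLinearGroup.scalar (Fin 1) U ∈
      valuedCongruenceSubgroup (Fin 1) (1 : WithZero (Multiplicative ℤ)) := by
  rw [mem_valuedCongruenceSubgroup_iff]
  refine ⟨fun i j => ?_, fun i j => ?_, fun i j => ?_⟩
  · simp only [Matrix.GeneralLinearGroup.coe_scalar, Matrix.scalar_apply, Matrix.diagonal_apply]
    split_ifs
    · exact hU
    · simp
  · rw [← map_inv]
    simp only [Matrix.GeneralLinearGroup.coe_scalar, Matrix.scalar_apply, Matrix.diagonal_apply]
    split_ifs
    · exact hU'
    · simp
  · rw [Matrix.sub_apply]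
    simp only [Matrix.GeneralLinearGroup.coe_scalar, Matrix.scalar_apply, Matrix.diagonal_apply,
      Matrix.one_apply]
    split_ifs
    · exact (Valuation.map_sub _ _ _).trans (max_le hU (by simp))
    · simp

/-- **`W` unramified at `v` ⟹ `χ_W` unramified at `v`.** If `W` has a non-zero vector fixed by a
principal congruence subgroup `K(𝔫)` with `v ∤ 𝔫` (`IsUnramifiedAt`), then, `K(𝔫)` being
`GL_1(𝒪_v)` at `v` (`isMaximalAt_principalCongruenceLevel`), every local unit `u ∈ 𝒪_vˣ` fixes
that vector, so `χ_W(u) = ω_W(scalar u) = 1`. [folklore] -/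
theorem isUnramifiedAt_heckeCharacter (hW : W.toContRep.IsTopIrreducible)
    {v : HeightOneSpectrum (𝓞 K)} (h : IsUnramifiedAt W v) :
    (heckeCharacter hW).IsUnramifiedAt v := by
  obtain ⟨𝔫, h𝔫, hv, f, hfK, hf0⟩ := h.exists_mem_fixedVectors
  intro u
  refine Units.ext ?_
  rw [GaloisRepresentations.HeckeCharacter.localComponent_apply, coe_heckeCharacter_apply,
    Units.val_one]
  refine eigenvalue_eq_one_of_apply_eq hW hf0 ?_
  refine (ContRepresentation.ClosedSubrep.mem_fixedVectors _ _ f).mp hfK _ ?_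
  rw [scalar_localUnits_eq_ofLocal]
  refine isMaximalAt_principalCongruenceLevel 1 K v h𝔫 hv ⟨_, ?_, rfl⟩
  exact scalar_mem_valuedCongruenceSubgroup_one v
    ((HeightOneSpectrum.mem_adicCompletionIntegers (R := 𝓞 K) K v).mp
      (u : v.adicCompletionIntegers K).2)
    ((HeightOneSpectrum.mem_adicCompletionIntegers (R := 𝓞 K) K v).mp
      ((u⁻¹ : (v.adicCompletionIntegers K)ˣ) : v.adicCompletionIntegers K).2)

/-- **Honest Satake parameters at unramified places are values at uniformizers of `χ_W`**: if
`W` has Satake parameter `α` at `v` with respect to `K(𝔫)`, `v ∤ 𝔫 ≠ 0`, and the uniformizer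
`ϖ`, then `α = {χ_W(ϖ_v)}` (`HeckeCharacter.valueAtUniformizer`, independent of `ϖ` because `χ_W`
is unramified at `v`; Tate (1950), §2.5). [folklore] -/
theorem _root_.Literature.NumberTheory.Automorphic.HasSatakeParameterAt.eq_singleton_valueAtUniformizer
    (hW : W.toContRep.IsTopIrreducible) {𝔫 : Ideal (𝓞 K)} (h𝔫 : 𝔫 ≠ 0)
    {v : HeightOneSpectrum (𝓞 K)} (hv : ¬ v.asIdeal ∣ 𝔫) {ϖ : (v.adicCompletion K)ˣ}
    {α : Multiset ℂ} (h : HasSatakeParameterAt W (principalCongruenceLevel 1 K 𝔫) v ϖ α) :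
    α = {(heckeCharacter hW).valueAtUniformizer v} := by
  have hur : (heckeCharacter hW).IsUnramifiedAt v :=
    isUnramifiedAt_heckeCharacter hW ⟨𝔫, h𝔫, hv, ϖ, α, h⟩
  rw [h.eq_singleton_heckeCharacter hW, Multiset.singleton_inj,
    ← GaloisRepresentations.HeckeCharacter.localComponent_eq_valueAtUniformizer hur h.1]
  rfl

end GLOne

/-! ### Cuspidal automorphic representations of `GL_1` -/

namespace CuspidalAutomorphicRepGL

/-- **The Hecke character of a cuspidal automorphic representation `Π` of `GL_1(𝔸_K)`**
(`GLOne.heckeCharacter` of the irreducible closed subrepresentation `Π ≤ L²_cusp = L²`): the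
unitary character `χ_Π` of `𝔸_Kˣ ⧸ Kˣ ℝ_{>0}` by which `GL_1(𝔸_K) = 𝔸_Kˣ` acts on `Π`
(Jacquet–Langlands (1970), §9, §12; Gelbart (1975), §2; Tate (1950), §4). [folklore] -/
def heckeCharacter (P : CuspidalAutomorphicRepGL 1 K μ) : GaloisRepresentations.HeckeCharacter K :=
  GLOne.heckeCharacter P.isTopIrreducible

/-- `χ_Π` is unitary. [folklore] -/
theorem isUnitary_heckeCharacter (P : CuspidalAutomorphicRepGL 1 K μ) : P.heckeCharacter.IsUnitary :=
  GLOne.isUnitary_heckeCharacter P.isTopIrreducible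

/-- `R(x) f = χ_Π(x) f` for `f ∈ Π` and `x ∈ 𝔸_Kˣ = GL_1(𝔸_K)` (as the scalar matrix of `x`).
[folklore] -/
theorem toContRep_scalar_apply (P : CuspidalAutomorphicRepGL 1 K μ) (x : (AdeleRing (𝓞 K) K)ˣ)
    (f : P.1.toSubmodule) :
    P.1.toContRep (Matrix.GeneralLinearGroup.scalar (Fin 1) x) f =
      ((P.heckeCharacter x : ℂˣ) : ℂ) • f :=
  GLOne.toContRep_apply_eq_eigenvalue_smul P.isTopIrreducible _ f

/-- **An honest Satake family of `Π : GL_1` off `S` is `v ↦ {χ_Π(ϖ_v)}` off `S`.** [folklore] -/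
theorem _root_.Literature.NumberTheory.Automorphic.IsSatakeFamilyOf.eq_singleton_valueAtUniformizer
    {P : CuspidalAutomorphicRepGL 1 K μ} {S : Set (HeightOneSpectrum (𝓞 K))} {α : SatakeFamily K}
    (hα : IsSatakeFamilyOf P S α) {v : HeightOneSpectrum (𝓞 K)} (hv : v ∉ S) :
    α v = {P.heckeCharacter.valueAtUniformizer v} := by
  obtain ⟨𝔫, h𝔫, hv𝔫, ϖ, hϖ⟩ := hα v hv
  exact hϖ.eq_singleton_valueAtUniformizer P.isTopIrreducible h𝔫 hv𝔫

/-- Off `S`, `Π` — hence `χ_Π` — is unramified. [folklore] -/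
theorem _root_.Literature.NumberTheory.Automorphic.IsSatakeFamilyOf.isUnramifiedAt_heckeCharacter
    {P : CuspidalAutomorphicRepGL 1 K μ} {S : Set (HeightOneSpectrum (𝓞 K))} {α : SatakeFamily K}
    (hα : IsSatakeFamilyOf P S α) {v : HeightOneSpectrum (𝓞 K)} (hv : v ∉ S) :
    P.heckeCharacter.IsUnramifiedAt v :=
  GLOne.isUnramifiedAt_heckeCharacter P.isTopIrreducible (hα.isUnramifiedAt hv)

/-- **The honest partial standard L-function of `Π : GL_1` is the partial Hecke L-function of
`χ_Π`:** `L^S(s, Π) = ∏'_{v ∉ S} (1 - χ_Π(ϖ_v) q_v^{-s})⁻¹` (all `s`; both sides are the same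
`tprod`). [folklore] -/
theorem partialStandardL_eq_tprod_heckeCharacter {P : CuspidalAutomorphicRepGL 1 K μ}
    {S : Set (HeightOneSpectrum (𝓞 K))} {α : SatakeFamily K} (hα : IsSatakeFamilyOf P S α) (s : ℂ) :
    partialStandardL S α s = ∏' v : {v : HeightOneSpectrum (𝓞 K) // v ∉ S},
      (1 - P.heckeCharacter.valueAtUniformizer v.1 * ((v.1.residueCard : ℂ) ^ (-s)))⁻¹ := by
  unfold partialStandardL
  refine tprod_congr fun v => ?_
  rw [hα.eq_singleton_valueAtUniformizer v.2, eval_eulerPolynomial_singleton]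

end CuspidalAutomorphicRepGL

end EigenCharacter

/-! ### Finite sets of places as divisors of an ideal -/

section Places

variable {K : Type} [Field K] [NumberField K]

/-- For a finite set `S` of finite places, `∏_{w ∈ S} 𝔭_w ≤ 𝔭_v ↔ v ∈ S` (prime avoidance for
the prime `𝔭_v` and maximality of the `𝔭_w`). [folklore] -/
theorem prod_asIdeal_le_iff (S : Finset (HeightOneSpectrum (𝓞 K))) (v : HeightOneSpectrum (𝓞 K)) :
    (∏ w ∈ S, w.asIdeal) ≤ v.asIdeal ↔ v ∈ S := by
  constructor
  · intro h
    obtain ⟨w, hw, hle⟩ := (Ideal.IsPrime.prod_le v.isPrime).mp h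
    have : w = v := HeightOneSpectrum.ext (w.isMaximal.eq_of_le v.isPrime.ne_top hle)
    exact this ▸ hw
  · intro hv
    exact (Ideal.prod_le_inf.trans (Finset.inf_le hv) : (∏ w ∈ S, w.asIdeal) ≤ v.asIdeal)

omit [NumberField K] in
/-- `∏_{w ∈ S} 𝔭_w ≠ 0`. [folklore] -/
theorem prod_asIdeal_ne_bot (S : Finset (HeightOneSpectrum (𝓞 K))) :
    (∏ w ∈ S, w.asIdeal) ≠ ⊥ :=
  Finset.prod_ne_zero_iff.mpr fun w _ => w.ne_bot

end Places

/-! ### Partial Hecke L-functions from Tate's theorem -/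

section HeckeL

variable {K : Type} [Field K] [NumberField K]

/-- **Partial Hecke L-functions are meromorphic, granting Tate's theorem.** Let `χ` be a unitary
Hecke character of `K`, unramified outside the finite set `S` of finite places, and suppose the
Hecke L-function `L(s, χ) = ∏_{v unramified} (1 - χ(ϖ_v) q_v^{-s})⁻¹` has meromorphic
continuation to `ℂ` (`LFunction.HasMeromorphicContinuation (heckeLFunction χ)`: Tate (1950),
Thm. 4.4.1; Hecke (1920)). Then so does the partial Euler product
`L^S(s, χ) = ∏_{v ∉ S} (1 - χ(ϖ_v) q_v^{-s})⁻¹`: on `re s > 1`,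
`L(s, χ) = (∏_{v ∈ S, χ_v unramified} (1 - χ(ϖ_v) q_v^{-s})⁻¹) · L^S(s, χ)`
(`HeckeCharacter.heckeLFunction_eq_prod_mul_tprod` with `𝔪 = ∏_{v ∈ S} 𝔭_v`, resting on the proved
convergence `multipliable_heckeLFunction_holds`), so the meromorphic function
`g₀(s) · ∏_{v ∈ S, unr.} (1 - χ(ϖ_v) q_v^{-s})` (`g₀` the continuation of `L(s, χ)`) agrees with
`L^S(s, χ)` at every `s`, `re s > 1`, off the closed discrete zero set of the finite product
(`eventually_prod_eval_residueCard_cpow_neg_ne_zero`); patch with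
`LFunction.hasMeromorphicContinuation_of_eventually_eq` (Neukirch, *ANT* VII §8, remark before
(8.5)). [cite: TateThesis1967, Thm. 4.4.1] -/
theorem _root_.Literature.NumberTheory.GaloisRepresentations.HeckeCharacter.hasMeromorphicContinuation_tprod_of_tate
    {χ : GaloisRepresentations.HeckeCharacter K} (hunit : χ.IsUnitary)
    (hT : GaloisRepresentations.LFunction.HasMeromorphicContinuation
      (GaloisRepresentations.heckeLFunction χ))
    (S : Finset (HeightOneSpectrum (𝓞 K))) (hur : ∀ v ∉ S, χ.IsUnramifiedAt v) :
    GaloisRepresentations.LFunction.HasMeromorphicContinuation fun s : ℂ =>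
      ∏' v : {v : HeightOneSpectrum (𝓞 K) // v ∉ (↑S : Set (HeightOneSpectrum (𝓞 K)))},
        (1 - χ.valueAtUniformizer v.1 * ((v.1.residueCard : ℂ) ^ (-s)))⁻¹ := by
  classical
  obtain ⟨g₀, hg₀, hg₀L⟩ := hT
  have h𝔪 : (∏ w ∈ S, w.asIdeal) ≠ ⊥ := prod_asIdeal_ne_bot S
  have hmem : ∀ v, (∏ w ∈ S, w.asIdeal) ≤ v.asIdeal ↔ v ∈ S := prod_asIdeal_le_iff S
  have hur' : ∀ v : HeightOneSpectrum (𝓞 K), ¬ (∏ w ∈ S, w.asIdeal) ≤ v.asIdeal →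
      χ.IsUnramifiedAt v := fun v hv => hur v fun hvS => hv ((hmem v).mpr hvS)
  have hD : ∀ v, v ∈ S.filter (fun v => χ.IsUnramifiedAt v) ↔
      (∏ w ∈ S, w.asIdeal) ≤ v.asIdeal ∧ χ.IsUnramifiedAt v := fun v => by
    rw [Finset.mem_filter, hmem]
  have hQ0 : ∀ v ∈ S.filter (fun v => χ.IsUnramifiedAt v),
      (eulerPolynomial {χ.valueAtUniformizer v}).eval 0 ≠ 0 := fun v _ => by
    rw [eval_zero_eulerPolynomial]; exact one_ne_zero
  have hM : Differentiable ℂ fun z : ℂ => ∏ v ∈ S.filter (fun v => χ.IsUnramifiedAt v),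
      (eulerPolynomial {χ.valueAtUniformizer v}).eval ((v.residueCard : ℂ) ^ (-z)) :=
    differentiable_prod_eval_residueCard_cpow_neg _ _
  have hMne := eventually_prod_eval_residueCard_cpow_neg_ne_zero
    (S.filter fun v => χ.IsUnramifiedAt v) (fun v => eulerPolynomial {χ.valueAtUniformizer v}) hQ0
  refine LFunction.hasMeromorphicContinuation_of_eventually_eq
    (g := fun z => g₀ z * ∏ v ∈ S.filter (fun v => χ.IsUnramifiedAt v),
      (eulerPolynomial {χ.valueAtUniformizer v}).eval ((v.residueCard : ℂ) ^ (-z)))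
    (hg₀.fun_mul fun x => (hM.analyticAt x).meromorphicAt) fun x => ?_
  filter_upwards [hMne x] with z hz hzre
  -- reindexing `{v // ¬ 𝔪 ≤ 𝔭_v} ≃ {v // v ∉ S}` (`Equiv.subtypeEquivRight`, definitionally the
  -- identity on the underlying places)
  have htp : (∏' v : {v : HeightOneSpectrum (𝓞 K) // ¬ (∏ w ∈ S, w.asIdeal) ≤ v.asIdeal},
      (1 - χ.valueAtUniformizer v.1 * ((v.1.residueCard : ℂ) ^ (-z)))⁻¹) =
        ∏' v : {v : HeightOneSpectrum (𝓞 K) // v ∉ (↑S : Set (HeightOneSpectrum (𝓞 K)))},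
          (1 - χ.valueAtUniformizer v.1 * ((v.1.residueCard : ℂ) ^ (-z)))⁻¹ :=
    Equiv.tprod_eq (Equiv.subtypeEquivRight fun v =>
        (show ¬ (∏ w ∈ S, w.asIdeal) ≤ v.asIdeal ↔ v ∉ (↑S : Set (HeightOneSpectrum (𝓞 K))) by
          rw [hmem v, Finset.mem_coe]))
      fun b => (1 - χ.valueAtUniformizer b.1 * ((b.1.residueCard : ℂ) ^ (-z)))⁻¹
  rw [hg₀L z hzre, GaloisRepresentations.HeckeCharacter.heckeLFunction_eq_prod_mul_tprod hunit h𝔪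
    hur' _ hD hzre, htp]
  simp only [eval_eulerPolynomial_singleton] at hz ⊢
  rw [mul_right_comm, Finset.prod_inv_distrib, inv_mul_cancel₀ hz, one_mul]

end HeckeL

/-! ### lang.S21 for `GL_1` from Tate's thesis -/

section Tate

variable {K : Type} [Field K] [NumberField K]
  {μ : Measure (AdelicGroupData.gl 1 K).automorphicQuotient}
  [(AdelicGroupData.gl 1 K).IsAutomorphicMeasure μ]

/-- **Meromorphic continuation of `L^S(s, Π)` for a cuspidal `Π` of `GL_1(𝔸_K)`, from Tate's
theorem for `χ_Π`.** Let `Π` be a cuspidal automorphic representation of `GL_1(𝔸_K)` — a unitary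
character `χ = χ_Π` of `𝔸_Kˣ ⧸ Kˣ ℝ_{>0}` (`CuspidalAutomorphicRepGL.heckeCharacter`) — and `α` an
honest Satake family of `Π` off the finite set `S`, so that `L^S(s, Π) = L^S(s, χ) =
∏_{v ∉ S} (1 - χ(ϖ_v) q_v^{-s})⁻¹` (`partialStandardL_eq_tprod_heckeCharacter`) with `χ`
unramified off `S`. Granting the meromorphic continuation of `L(s, χ)`
(`heckeLFunction_hasMeromorphicContinuation χ`: Tate (1950), Thm. 4.4.1), `L^S(s, Π)` has
meromorphic continuation to `ℂ` (`HeckeCharacter.hasMeromorphicContinuation_tprod_of_tate`). No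
hypothesis "`S ⊇` ramified places" is needed. [cite: TateThesis1967, Thm. 4.4.1] -/
theorem hasMeromorphicContinuation_partialStandardL_of_tate {P : CuspidalAutomorphicRepGL 1 K μ}
    (hT : GaloisRepresentations.heckeLFunction_hasMeromorphicContinuation P.heckeCharacter)
    {S : Finset (HeightOneSpectrum (𝓞 K))} {α : SatakeFamily K} (hα : IsSatakeFamilyOf P ↑S α) :
    GaloisRepresentations.LFunction.HasMeromorphicContinuation (partialStandardL ↑S α) := by
  have heq : partialStandardL (↑S : Set (HeightOneSpectrum (𝓞 K))) α = fun s : ℂ =>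
      ∏' v : {v : HeightOneSpectrum (𝓞 K) // v ∉ (↑S : Set (HeightOneSpectrum (𝓞 K)))},
        (1 - P.heckeCharacter.valueAtUniformizer v.1 * ((v.1.residueCard : ℂ) ^ (-s)))⁻¹ :=
    funext fun s => CuspidalAutomorphicRepGL.partialStandardL_eq_tprod_heckeCharacter hα s
  rw [heq]
  exact GaloisRepresentations.HeckeCharacter.hasMeromorphicContinuation_tprod_of_tate
    P.isUnitary_heckeCharacter (hT P.isUnitary_heckeCharacter) S
    fun v hv => hα.isUnramifiedAt_heckeCharacter fun h => hv (Finset.mem_coe.mp h)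

/-- **lang.S21 (partial L-functions) for `GL_1` from Tate's thesis.** Granting the meromorphic
continuation of the Hecke L-functions of the unitary Hecke characters of `K`
(`heckeLFunction_hasMeromorphicContinuation`, Tate (1950), Thm. 4.4.1 — the same named input as
the abelian/Brauer Artin cluster `ArtinLFunctionsBrauer`), the named fact
`partialStandardL_hasMeromorphicContinuation` holds for `n = 1` over the tree's honest `L²`
definitions: every honest partial standard L-function of every cuspidal automorphic
representation of `GL_1(𝔸_K)` is meromorphic on `ℂ`. [cite: TateThesis1967, Thm. 4.4.1] -/
theorem partialStandardL_hasMeromorphicContinuation_one_of_tate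
    (hT : ∀ χ : GaloisRepresentations.HeckeCharacter K,
      GaloisRepresentations.heckeLFunction_hasMeromorphicContinuation χ) :
    partialStandardL_hasMeromorphicContinuation (n := 1) (K := K) (μ := μ) :=
  fun P _ _ hα _ => hasMeromorphicContinuation_partialStandardL_of_tate (hT P.heckeCharacter) hα

/-- **Godement–Jacquet's Thm. 13.8 for `L^S`, `n = 1`, from Tate** (the half-plane form
`GodementJacquet1972_meromorphic_partialStandardL` of `GodementJacquetPartialL`, with abscissa
`x₀ = 1`). [cite: TateThesis1967, Thm. 4.4.1] -/
theorem GodementJacquet1972_meromorphic_partialStandardL_one_of_tate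
    (hT : ∀ χ : GaloisRepresentations.HeckeCharacter K,
      GaloisRepresentations.heckeLFunction_hasMeromorphicContinuation χ) :
    GodementJacquet1972_meromorphic_partialStandardL (n := 1) (K := K) (μ := μ) := by
  intro P S α hα _
  obtain ⟨g, hg, hgL⟩ :=
    hasMeromorphicContinuation_partialStandardL_of_tate (hT P.heckeCharacter) hα
  exact ⟨1, g, hg, hgL⟩

/-- **lang.S21 (meromorphic `L(s, Π)`, all cuspidal `Π`) for `GL_1` from Tate**: the named fact
`godementJacquet_hasMeromorphicContinuation` for `n = 1`, through
`godementJacquet_hasMeromorphicContinuation_of_partialStandardL` (the datum with exceptional set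
the ramified places and junk-free factors elsewhere, `GodementJacquetPartialL`).
[cite: TateThesis1967, Thm. 4.4.1] -/
theorem godementJacquet_hasMeromorphicContinuation_one_of_tate
    (hT : ∀ χ : GaloisRepresentations.HeckeCharacter K,
      GaloisRepresentations.heckeLFunction_hasMeromorphicContinuation χ) :
    godementJacquet_hasMeromorphicContinuation (n := 1) (K := K) (μ := μ) :=
  godementJacquet_hasMeromorphicContinuation_of_partialStandardL
    (partialStandardL_hasMeromorphicContinuation_one_of_tate hT)

/-- **Finite-order `χ_Π`: lang.S21 for `Π` from Hecke (1917).** If the Hecke character of the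
cuspidal `Π : GL_1` has finite order, the continuation of `L^S(s, Π)` already follows from the
meromorphic continuation of the ray class L-series of `K`
(`rayClassLSeries_hasMeromorphicContinuation K`, Hecke (1917); Neukirch VII (8.5)), through
`HeckeCharacter.hasMeromorphicContinuation_of_isFiniteOrder` of `HeckeCharacterDictionary`.
[cite: NeukirchANT1999, Ch. VII Thm. (8.5)] -/
theorem hasMeromorphicContinuation_partialStandardL_of_isFiniteOrder
    (hH : LFunctions.rayClassLSeries_hasMeromorphicContinuation K) {P : CuspidalAutomorphicRepGL 1 K μ}
    (hP : P.heckeCharacter.IsFiniteOrder) {S : Finset (HeightOneSpectrum (𝓞 K))} {α : SatakeFamily K}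
    (hα : IsSatakeFamilyOf P ↑S α) :
    GaloisRepresentations.LFunction.HasMeromorphicContinuation (partialStandardL ↑S α) :=
  hasMeromorphicContinuation_partialStandardL_of_tate
    (fun _ => GaloisRepresentations.HeckeCharacter.hasMeromorphicContinuation_of_isFiniteOrder hH hP)
    hα

end Tate

/-! ### The frontier of lang.S21 (partial L-functions) for general `n`, proved inputs inlined -/

section Frontier

variable {n : ℕ} {K : Type} [Field K] [NumberField K]
  {μ : Measure (AdelicGroupData.gl n K).automorphicQuotient}
  [(AdelicGroupData.gl n K).IsAutomorphicMeasure μ]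

/-- **The trivial representation of `GL_1`, unconditionally.** For the trivial cuspidal
representation `Π` of `GL_1(𝔸_K)` every honest `L^S(s, Π) = ζ_K^S(s)` is meromorphic on `ℂ`:
`hasMeromorphicContinuation_partialStandardL_of_isTrivialSubrep` of `AutomorphicLFunctionsProofs`
fed with Hecke's theorems, now proved in the tree (`exists_isDedekindZetaContinuation_holds`,
`tendsto_sub_one_mul_dedekindZetaCont_holds`). [folklore] -/
theorem hasMeromorphicContinuation_partialStandardL_of_isTrivialSubrep_holds
    {μ₁ : Measure (AdelicGroupData.gl 1 K).automorphicQuotient}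
    [(AdelicGroupData.gl 1 K).IsAutomorphicMeasure μ₁]
    {P : CuspidalAutomorphicRepGL 1 K μ₁} (hP : P.1.IsTrivialSubrep)
    {S : Finset (HeightOneSpectrum (𝓞 K))} {α : SatakeFamily K} (hα : IsSatakeFamilyOf P ↑S α) :
    GaloisRepresentations.LFunction.HasMeromorphicContinuation (partialStandardL ↑S α) :=
  hasMeromorphicContinuation_partialStandardL_of_isTrivialSubrep
    (LFunctions.NumberField.exists_isDedekindZetaContinuation_holds K)
    (LFunctions.tendsto_sub_one_mul_dedekindZetaCont_holds K) hP hα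

/-- **lang.S21 (partial L-functions) from the existence form of Godement–Jacquet and
Jacquet–Shalika alone.** With Flath's theorem (`Flath1979_heckeOperatorAt_ofLocal_eq_smul_holds`,
`UnramifiedHeckeScalarsFlathProofs`) and Hecke's continuation of `ζ_K` with its simple pole
(`exists_isDedekindZetaContinuation_holds`, `tendsto_sub_one_mul_dedekindZetaCont_holds`) proved
in the tree, `partialStandardL_hasMeromorphicContinuation_of_godementJacquet_of_hecke` of
`AutomorphicLFunctionsProofs` leaves exactly two named inputs: the existence form
`godementJacquet` of lang.S21 (Godement–Jacquet (1972), Thm. 13.8: entire `L(s, Π)` with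
functional equation for `Π` not the trivial representation of `GL_1`) and Jacquet–Shalika's
convergence `multipliable_partialStandardL` (Amer. J. Math. 103 (1981), Thm. (5.3)).
[cite: GodementJacquet1972, Thm. 13.8] [cite: JacquetShalikaAJM1981, Thm. (5.3)] -/
theorem partialStandardL_hasMeromorphicContinuation_of_godementJacquet_of_JS
    (hGJ : godementJacquet (n := n) (K := K) (μ := μ))
    (hJS : multipliable_partialStandardL (n := n) (K := K) (μ := μ)) :
    partialStandardL_hasMeromorphicContinuation (n := n) (K := K) (μ := μ) :=
  partialStandardL_hasMeromorphicContinuation_of_godementJacquet_of_hecke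
    Flath1979_heckeOperatorAt_ofLocal_eq_smul_holds hGJ hJS
    (LFunctions.NumberField.exists_isDedekindZetaContinuation_holds K)
    (LFunctions.tendsto_sub_one_mul_dedekindZetaCont_holds K)

/-- **lang.S21 (partial L-functions) from the meromorphic form of Godement–Jacquet and
Jacquet–Shalika alone** (`partialStandardL_hasMeromorphicContinuation_of_facts` with Flath's theorem
inlined). [cite: GodementJacquet1972, Thm. 13.8] [cite: JacquetShalikaAJM1981, Thm. (5.3)] -/
theorem partialStandardL_hasMeromorphicContinuation_of_GJ_of_JS
    (hGJ : godementJacquet_hasMeromorphicContinuation (n := n) (K := K) (μ := μ))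
    (hJS : multipliable_partialStandardL (n := n) (K := K) (μ := μ)) :
    partialStandardL_hasMeromorphicContinuation (n := n) (K := K) (μ := μ) :=
  partialStandardL_hasMeromorphicContinuation_of_facts
    Flath1979_heckeOperatorAt_ofLocal_eq_smul_holds hGJ hJS

/-- **In rank `n ≤ 1` the Jacquet–Shalika input is proved**, so lang.S21 (partial L-functions)
for `GL_1` and `GL_0` rests on Godement–Jacquet's half-plane continuation alone
(`GodementJacquet1972_meromorphic_partialStandardL`; for `n = 1` this is Tate's theorem,
`GodementJacquet1972_meromorphic_partialStandardL_one_of_tate`):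
`JacquetShalika1981_differentiableOn_partialStandardL_of_le_one` of `GodementJacquetPartialLProofs`
(the honest Satake parameters of `GL_1` have absolute value `1`).
[cite: GodementJacquet1972, Thm. 13.8] -/
theorem partialStandardL_hasMeromorphicContinuation_of_GJ_of_le_one (hn : n ≤ 1)
    (hGJ : GodementJacquet1972_meromorphic_partialStandardL (n := n) (K := K) (μ := μ)) :
    partialStandardL_hasMeromorphicContinuation (n := n) (K := K) (μ := μ) :=
  partialStandardL_hasMeromorphicContinuation_of_halfPlane hGJ
    (JacquetShalika1981_differentiableOn_partialStandardL_of_le_one hn)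

end Frontier

/-! ### The eigencharacter as a unitary automorphic character of `GL_1(𝔸_K)` -/

section AutomorphicCharacter

variable {K : Type} [Field K] [NumberField K]
  {μ : Measure (AdelicGroupData.gl 1 K).automorphicQuotient}
  [(AdelicGroupData.gl 1 K).IsAutomorphicMeasure μ]
  {W : ContRepresentation.ClosedSubrep ((AdelicGroupData.gl 1 K).rightRegular μ)}

/-- **The eigencharacter `ω_W` of an irreducible `W ≤ L²(GL_1(𝔸_K) ⧸ ℝ_{>0} GL_1(K))` as a unitary
automorphic character of `GL_1(𝔸_K)`** (`AdelicGroupData.AutomorphicCharacter`: a continuous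
unitary character of `G(𝔸_K)` trivial on `A_G · G(K)`): the four fields are `GLOne.eigenvalueHom`,
`GLOne.continuous_eigenvalue`, `GLOne.norm_eigenvalue` and
`GLOne.eigenvalue_eq_one_of_mem_quotientSubgroup`. Through it `W` enters the twisting machinery of
`AutomorphicTwist` (`ClosedSubrep.twist`); the Hecke character `χ_W` is its composition with the
scalar embedding `𝔸_Kˣ → GL_1(𝔸_K)` (`GLOne.heckeCharacter_apply_eq_automorphicCharacter`)
(Arthur–Clozel (1989), Ch. 3 §1; Borel–Jacquet (1979), §4). [folklore] -/
def GLOne.automorphicCharacter (hW : W.toContRep.IsTopIrreducible) :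
    (AdelicGroupData.gl 1 K).AutomorphicCharacter where
  toMonoidHom := (GLOne.eigenvalueHom hW).toHomUnits
  continuous_coe := GLOne.continuous_eigenvalue hW
  norm_apply := GLOne.norm_eigenvalue hW
  map_eq_one_of_mem _ hg := Units.ext (GLOne.eigenvalue_eq_one_of_mem_quotientSubgroup hW hg)

/-- Unfolding: `(automorphicCharacter hW g : ℂ) = ω_W(g)`. [folklore] -/
@[simp]
theorem GLOne.coe_automorphicCharacter_apply (hW : W.toContRep.IsTopIrreducible)
    (g : (AdelicGroupData.gl 1 K).Adelic) :
    ((GLOne.automorphicCharacter hW g : ℂˣ) : ℂ) = GLOne.eigenvalue hW g :=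
  rfl

/-- `χ_W = ω_W ∘ scalar`: the Hecke character of `W` is its automorphic character composed with
the scalar embedding `𝔸_Kˣ →* GL_1(𝔸_K)` (definitional). [folklore] -/
theorem GLOne.heckeCharacter_apply_eq_automorphicCharacter (hW : W.toContRep.IsTopIrreducible)
    (x : (AdeleRing (𝓞 K) K)ˣ) :
    GLOne.heckeCharacter hW x =
      GLOne.automorphicCharacter hW (Matrix.GeneralLinearGroup.scalar (Fin 1) x) :=
  rfl

/-- The automorphic character of a cuspidal automorphic representation `Π` of `GL_1(𝔸_K)`.
[folklore] -/
def CuspidalAutomorphicRepGL.automorphicCharacter (P : CuspidalAutomorphicRepGL 1 K μ) :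
    (AdelicGroupData.gl 1 K).AutomorphicCharacter :=
  GLOne.automorphicCharacter P.isTopIrreducible

/-- `R(g) f = ω_Π(g) f` for `f ∈ Π`, `g ∈ GL_1(𝔸_K)`. [folklore] -/
theorem CuspidalAutomorphicRepGL.toContRep_apply_eq_automorphicCharacter_smul
    (P : CuspidalAutomorphicRepGL 1 K μ) (g : (AdelicGroupData.gl 1 K).Adelic) (f : P.1.toSubmodule) :
    P.1.toContRep g f = ((P.automorphicCharacter g : ℂˣ) : ℂ) • f :=
  GLOne.toContRep_apply_eq_eigenvalue_smul P.isTopIrreducible g f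

end AutomorphicCharacter

end Literature.NumberTheory.Automorphic
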